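import Mathlib
import Summits.ValiantsHypothesis.ValiantsHypothesis.Theorems.ValuativeGCTValuativeFlipPencilEvalCheckFast
import Summits.ValiantsHypothesis.ValiantsHypothesis.Theorems.ValuativeGCTValuativeFlipHeadCensusPointwise

/-!
# Certified small case `N = 11`: the four-row census FLIPS at `(n, m) = (11, 12)` and `(11, 13)`

Helper file (`--supports stmt-ValiantsHypothesis-12624`, computational lane: one `native_decide`) for
crux `ValuativeGCT.ValuativeFlip`, line `four-row-count`, wall-breaker axis k14 "small cases certified".

* `pencilCheckK_ten` — the FAST evaluation certificate (`…PencilEvalCheckFast.lean`: pruned/fused `ℕ`-DP,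
  members restricted to deleted rows `k < 9`) at inner size `N = 11` (`n = 10`, `K = 9`, `P = 358` points,
  `r = 353`) evaluates to `true` (`native_decide`; ≈ 6–7 min in the interpreter; the unrestricted
  `pencilCheck 10 380 364 = true` — rank `364 = C(14,3)` — was measured in-session in 1223 s but exceeds the
  gate's 600 s budget);
* `pencilRank_eleven` — hence `353 ≤ dim span{X_t · (∂_{kl} per_11)(M·X)}` for `M = pencilZ 10`
  (`le_finrank_of_pencilCheckK`; numerically the span is everything, `364`);
* `flipBody_eleven_thirteen`, `fourRow_census_eleven_thirteen`, `detObstruction_eleven_thirteen` — since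
  `2·13² + 13 + 2 = 353`: the body of the crux, the four-row census and a Mulmuley–Sohoni multiplicity
  obstruction at `(n, m) = (11, 13)` (two steps above the bottom, `m/n = 1.18`); and the same at `(11, 12)`
  (`302 ≤ 353`): `flipBody_eleven_twelve`, `detObstruction_eleven_twelve`.
[this crux's line four-row-count; Mulmuley–Sohoni 2008; BLMW 2011 §5.2] [folklore]
-/

set_option linter.dupNamespace false
set_option maxHeartbeats 800000

namespace Summit.ValiantsHypothesis.ValiantsHypothesis.Theorems.ValuativeFlip

open MvPolynomial
open scoped BigOperators Matrix
open Literature.NumberTheory.DiophantineGeometry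
open Literature.Computability.AlgebraicComplexity

/-- **The fast certificate at `N = 11` checks** (`n = 10`, deleted rows `k < 9`, `358` points, rank `353`).
[compute: native_decide, in-file] [folklore] -/
theorem pencilCheckK_ten : pencilCheckK 10 9 358 353 (by norm_num) (by norm_num) = true := by
  native_decide

/-- **Rank ≥ 353 at inner size 11**: the pencil family `X_t · (∂_{kl} per_11)(M·X)` of the integer pencil
`M = pencilZ 10` spans at least `353` dimensions (of the `364 = C(14,3)` quaternary forms of degree `11`;
`353 = 2·13² + 13 + 2` is what the cell `(11, 13)` needs). [this crux's line four-row-count; folklore] -/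
theorem pencilRank_eleven :
    353 ≤ Module.finrank ℂ ↥(Submodule.span ℂ (Set.range fun tc : Fin 4 × (Fin 11 × Fin 11) =>
      (X tc.1 : MvPolynomial (Fin 4) ℂ) *
        aeval (fun ij : Fin 11 × Fin 11 =>
          ∑ t : Fin 4, (fun ij t => ((pencilZ 10 ij t : ℤ) : ℂ)) ij t • (X t : MvPolynomial (Fin 4) ℂ))
          (pderiv tc.2 (perPoly (Fin 11) ℂ)))) :=
  le_finrank_of_pencilCheckK 10 9 358 353 (by norm_num) (by norm_num) pencilCheckK_ten

/-- **The four-row census flips at `(n, m) = (11, 13)`**: some `λ ⊢ 13δ` with at most four rows has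
`dim (Hom_{13δ} ⊓ SAND ⊓ HWSP(λ*)) < mult_{λ*} ℂ[Δ_13(X₀₀^2 · per_11)]`. [this crux's line four-row-count;
folklore] -/
theorem fourRow_census_eleven_thirteen :
    ∃ (δ : ℕ) (lam : Nat.Partition (13 * δ)), lam.parts.card ≤ 4 ∧
        Module.finrank ℂ ↥(MvPolynomial.homogeneousSubmodule (MatIdx 13 × MatIdx 13) ℂ (13 * δ) ⊓
          (⨅ (P : Matrix (Fin 13) (Fin 13) ℂ) (Q : Matrix (Fin 13) (Fin 13) ℂ) (_ : P.det = 1) (_ : Q.det = 1), LinearMap.ker ((MvPolynomial.aeval fun p : MatIdx 13 × MatIdx 13 => ∑ l : MatIdx 13, (P (ofLex p.2).1 (ofLex l).1 * Q (ofLex l).2 (ofLex p.2).2) • (MvPolynomial.X (p.1, l) : MvPolynomial (MatIdx 13 × MatIdx 13) ℂ)).toLinearMap - (LinearMap.id : MvPolynomial (MatIdx 13 × MatIdx 13) ℂ →ₗ[ℂ] MvPolynomial (MatIdx 13 × MatIdx 13) ℂ))) ⊓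
          (⨅ (g : Matrix.GeneralLinearGroup (MatIdx 13) ℂ) (_ : IsUpperTriangular g), LinearMap.ker ((MvPolynomial.aeval fun p : MatIdx 13 × MatIdx 13 => ∑ l : MatIdx 13, ((g⁻¹ : Matrix.GeneralLinearGroup (MatIdx 13) ℂ) : Matrix (MatIdx 13) (MatIdx 13) ℂ) p.1 l • (MvPolynomial.X (l, p.2) : MvPolynomial (MatIdx 13 × MatIdx 13) ℂ)).toLinearMap - weightChar ((Weight.dualOfPartition (13 * 13) lam).toMatIdx : Weight (MatIdx 13)) g • (LinearMap.id : MvPolynomial (MatIdx 13 × MatIdx 13) ℂ →ₗ[ℂ] MvPolynomial (MatIdx 13 × MatIdx 13) ℂ)))) <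
        orbitMultiplicity ℂ (paddedPerFormLex ℂ 11 13) 13 ((Weight.dualOfPartition (13 * 13) lam).toMatIdx : Weight (MatIdx 13)) :=
  fourRow_census_of_pencilRank 11 13 (by norm_num) (by norm_num) (fun ij t => ((pencilZ 10 ij t : ℤ) : ℂ))
    (fun t' : Fin 4 => ((0 : Fin (10 + 1)), Fin.castLE (by norm_num) t')) (pencilZ_cells_isUnit 10 (by norm_num))
    (le_trans (by norm_num) pencilRank_eleven)

/-- **The crux body at `(11, 13)`**: the body of `ValuativeGCT.ValuativeFlip` (verbatim `let χ`, `let T`)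
holds at `n = 11`, `m = 13` — a valuative flip two steps above the bottom of the window (`m/n = 13/11`), certified. [this crux's
line four-row-count; folklore] -/
theorem flipBody_eleven_thirteen :
    ∃ (U : Submodule ℂ (MatIdx 13 → ℂ)) (r δ : ℕ) (lam : Nat.Partition (13 * δ)), (∀ u ∈ U, (Matrix.of fun a b : Fin 13 => u (toLex (a, b))).rank ≤ r) ∧ lam.parts.card ≤ 13 * 13 ∧ (let χ : Weight (MatIdx 13) := (Weight.dualOfPartition (13 * 13) lam).toMatIdx; let T : Submodule ℂ (MvPolynomial (MatIdx 13 × MatIdx 13) ℂ) := MvPolynomial.homogeneousSubmodule (MatIdx 13 × MatIdx 13) ℂ (13 * δ) ⊓ ((MvPolynomial.vanishingIdeal ℂ {p : MatIdx 13 × MatIdx 13 → ℂ | ∀ j : MatIdx 13, (fun i => p (j, i)) ∈ U}) ^ (δ * (13 - r))).restrictScalars ℂ ⊓ (⨅ (M : Matrix (MatIdx 13) (MatIdx 13) ℂ) (_ : linSubst (MatIdx 13) ℂ M (detFormLex ℂ 13) = detFormLex ℂ 13), LinearMap.ker ((MvPolynomial.aeval (R := ℂ) fun p : MatIdx 13 ×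 MatIdx 13 => ∑ l : MatIdx 13, M l p.2 • MvPolynomial.X (p.1, l)).toLinearMap - LinearMap.id (R := ℂ) (M := MvPolynomial (MatIdx 13 × MatIdx 13) ℂ))) ⊓ (⨅ (g : Matrix.GeneralLinearGroup (MatIdx 13) ℂ) (_ : IsUpperTriangular g), LinearMap.ker ((MvPolynomial.aeval (R := ℂ) fun p : MatIdx 13 × MatIdx 13 => ∑ l : MatIdx 13, ((g⁻¹ : Matrix.GeneralLinearGroup (MatIdx 13) ℂ) : Matrix (MatIdx 13) (MatIdx 13) ℂ) p.1 l • MvPolynomial.X (l, p.2)).toLinearMap - weightChar χ g • LinearMap.id (R := ℂ) (M := MvPolynomial (MatIdx 13 × MatIdx 13) ℂ))); Module.finrank ℂ ↥T < orbitMultiplicity ℂ (paddedPerFormLex ℂ 11 13) 13 χ) :=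
  headFlipBody_of_pencilCert_at 11 13 (by norm_num) (by norm_num) (fun ij t => ((pencilZ 10 ij t : ℤ) : ℂ))
    (fun t' : Fin 4 => ((0 : Fin (10 + 1)), Fin.castLE (by norm_num) t')) (pencilZ_cells_isUnit 10 (by norm_num))
    (le_trans (by norm_num) pencilRank_eleven)

/-- **A multiplicity obstruction at `(11, 13)`**: some four-row `λ ⊢ 13δ` has
`mult_{λ*} ℂ[Δ(det_13)] < mult_{λ*} ℂ[Δ_13(X₀₀^2 · per_11)]` — a Mulmuley–Sohoni multiplicity obstruction for
the determinant versus the padded permanent above the bottom of the window, certified.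
[Mulmuley–Sohoni 2008; BLMW 2011 §5.2; this crux's line four-row-count] [folklore] -/
theorem detObstruction_eleven_thirteen :
    ∃ (δ : ℕ) (lam : Nat.Partition (13 * δ)), lam.parts.card ≤ 4 ∧
      orbitMultiplicity ℂ (detFormLex ℂ 13) 13 ((Weight.dualOfPartition (13 * 13) lam).toMatIdx : Weight (MatIdx 13)) <
        orbitMultiplicity ℂ (paddedPerFormLex ℂ 11 13) 13 ((Weight.dualOfPartition (13 * 13) lam).toMatIdx : Weight (MatIdx 13)) :=
  fourRow_detObstruction_of_pencilRank 11 13 (by norm_num) (by norm_num) (fun ij t => ((pencilZ 10 ij t : ℤ) : ℂ))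
    (fun t' : Fin 4 => ((0 : Fin (10 + 1)), Fin.castLE (by norm_num) t')) (pencilZ_cells_isUnit 10 (by norm_num))
    (le_trans (by norm_num) pencilRank_eleven)

/-- **The four-row census flips at `(n, m) = (11, 12)`**: some `λ ⊢ 12δ` with at most four rows has
`dim (Hom_{12δ} ⊓ SAND ⊓ HWSP(λ*)) < mult_{λ*} ℂ[Δ_12(X₀₀^1 · per_11)]`. [this crux's line four-row-count;
folklore] -/
theorem fourRow_census_eleven_twelve :
    ∃ (δ : ℕ) (lam : Nat.Partition (12 * δ)), lam.parts.card ≤ 4 ∧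
        Module.finrank ℂ ↥(MvPolynomial.homogeneousSubmodule (MatIdx 12 × MatIdx 12) ℂ (12 * δ) ⊓
          (⨅ (P : Matrix (Fin 12) (Fin 12) ℂ) (Q : Matrix (Fin 12) (Fin 12) ℂ) (_ : P.det = 1) (_ : Q.det = 1), LinearMap.ker ((MvPolynomial.aeval fun p : MatIdx 12 × MatIdx 12 => ∑ l : MatIdx 12, (P (ofLex p.2).1 (ofLex l).1 * Q (ofLex l).2 (ofLex p.2).2) • (MvPolynomial.X (p.1, l) : MvPolynomial (MatIdx 12 × MatIdx 12) ℂ)).toLinearMap - (LinearMap.id : MvPolynomial (MatIdx 12 × MatIdx 12) ℂ →ₗ[ℂ] MvPolynomial (MatIdx 12 × MatIdx 12) ℂ))) ⊓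
          (⨅ (g : Matrix.GeneralLinearGroup (MatIdx 12) ℂ) (_ : IsUpperTriangular g), LinearMap.ker ((MvPolynomial.aeval fun p : MatIdx 12 × MatIdx 12 => ∑ l : MatIdx 12, ((g⁻¹ : Matrix.GeneralLinearGroup (MatIdx 12) ℂ) : Matrix (MatIdx 12) (MatIdx 12) ℂ) p.1 l • (MvPolynomial.X (l, p.2) : MvPolynomial (MatIdx 12 × MatIdx 12) ℂ)).toLinearMap - weightChar ((Weight.dualOfPartition (12 * 12) lam).toMatIdx : Weight (MatIdx 12)) g • (LinearMap.id : MvPolynomial (MatIdx 12 × MatIdx 12) ℂ →ₗ[ℂ] MvPolynomial (MatIdx 12 × MatIdx 12) ℂ)))) <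
        orbitMultiplicity ℂ (paddedPerFormLex ℂ 11 12) 12 ((Weight.dualOfPartition (12 * 12) lam).toMatIdx : Weight (MatIdx 12)) :=
  fourRow_census_of_pencilRank 11 12 (by norm_num) (by norm_num) (fun ij t => ((pencilZ 10 ij t : ℤ) : ℂ))
    (fun t' : Fin 4 => ((0 : Fin (10 + 1)), Fin.castLE (by norm_num) t')) (pencilZ_cells_isUnit 10 (by norm_num))
    (le_trans (by norm_num) pencilRank_eleven)

/-- **The crux body at `(11, 12)`**: the body of `ValuativeGCT.ValuativeFlip` (verbatim `let χ`, `let T`)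
holds at `n = 11`, `m = 12` — a valuative flip above the bottom of the window, certified. [this crux's
line four-row-count; folklore] -/
theorem flipBody_eleven_twelve :
    ∃ (U : Submodule ℂ (MatIdx 12 → ℂ)) (r δ : ℕ) (lam : Nat.Partition (12 * δ)), (∀ u ∈ U, (Matrix.of fun a b : Fin 12 => u (toLex (a, b))).rank ≤ r) ∧ lam.parts.card ≤ 12 * 12 ∧ (let χ : Weight (MatIdx 12) := (Weight.dualOfPartition (12 * 12) lam).toMatIdx; let T : Submodule ℂ (MvPolynomial (MatIdx 12 × MatIdx 12) ℂ) := MvPolynomial.homogeneousSubmodule (MatIdx 12 × MatIdx 12) ℂ (12 * δ) ⊓ ((MvPolynomial.vanishingIdeal ℂ {p : MatIdx 12 × MatIdx 12 → ℂ | ∀ j : MatIdx 12, (fun i => p (j, i)) ∈ U}) ^ (δ * (12 - r))).restrictScalars ℂ ⊓ (⨅ (M : Matrix (MatIdx 12) (MatIdx 12) ℂ) (_ : linSubst (MatIdx 12) ℂ M (detFormLex ℂ 12) = detFormLex ℂ 12), LinearMap.ker ((MvPolynomial.aeval (R := ℂ) fun p : MatIdx 12 × MatIdx 12 => ∑ l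 : MatIdx 12, M l p.2 • MvPolynomial.X (p.1, l)).toLinearMap - LinearMap.id (R := ℂ) (M := MvPolynomial (MatIdx 12 × MatIdx 12) ℂ))) ⊓ (⨅ (g : Matrix.GeneralLinearGroup (MatIdx 12) ℂ) (_ : IsUpperTriangular g), LinearMap.ker ((MvPolynomial.aeval (R := ℂ) fun p : MatIdx 12 × MatIdx 12 => ∑ l : MatIdx 12, ((g⁻¹ : Matrix.GeneralLinearGroup (MatIdx 12) ℂ) : Matrix (MatIdx 12) (MatIdx 12) ℂ) p.1 l • MvPolynomial.X (l, p.2)).toLinearMap - weightChar χ g • LinearMap.id (R := ℂ) (M := MvPolynomial (MatIdx 12 × MatIdx 12) ℂ))); Module.finrank ℂ ↥T < orbitMultiplicity ℂ (paddedPerFormLex ℂ 11 12) 12 χ) :=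
  headFlipBody_of_pencilCert_at 11 12 (by norm_num) (by norm_num) (fun ij t => ((pencilZ 10 ij t : ℤ) : ℂ))
    (fun t' : Fin 4 => ((0 : Fin (10 + 1)), Fin.castLE (by norm_num) t')) (pencilZ_cells_isUnit 10 (by norm_num))
    (le_trans (by norm_num) pencilRank_eleven)

/-- **A multiplicity obstruction at `(11, 12)`**: some four-row `λ ⊢ 12δ` has
`mult_{λ*} ℂ[Δ(det_12)] < mult_{λ*} ℂ[Δ_12(X₀₀^1 · per_11)]` — a Mulmuley–Sohoni multiplicity obstruction for
the determinant versus the padded permanent above the bottom of the window, certified.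
[Mulmuley–Sohoni 2008; BLMW 2011 §5.2; this crux's line four-row-count] [folklore] -/
theorem detObstruction_eleven_twelve :
    ∃ (δ : ℕ) (lam : Nat.Partition (12 * δ)), lam.parts.card ≤ 4 ∧
      orbitMultiplicity ℂ (detFormLex ℂ 12) 12 ((Weight.dualOfPartition (12 * 12) lam).toMatIdx : Weight (MatIdx 12)) <
        orbitMultiplicity ℂ (paddedPerFormLex ℂ 11 12) 12 ((Weight.dualOfPartition (12 * 12) lam).toMatIdx : Weight (MatIdx 12)) :=
  fourRow_detObstruction_of_pencilRank 11 12 (by norm_num) (by norm_num) (fun ij t => ((pencilZ 10 ij t : ℤ) : ℂ))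
    (fun t' : Fin 4 => ((0 : Fin (10 + 1)), Fin.castLE (by norm_num) t')) (pencilZ_cells_isUnit 10 (by norm_num))
    (le_trans (by norm_num) pencilRank_eleven)

end Summit.ValiantsHypothesis.ValiantsHypothesis.Theorems.ValuativeFlip
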